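import Literature.Analysis.FluidPDE.LocalTypeIProofs
import Literature.Analysis.FunctionSpaces.WeakLpQuantitative
import HarnessLib

/-!
# Seregin 2019, §4: slice properties of a strong `L³_loc` limit — weak-`L³` slices and the
# vanishing of the pairings at the top time pass to the limit

Analysis/FluidPDE proofs-only file (theorems only: no definitions, no named facts, no `sorry`),
a tranche of the input `Literature.Analysis.FluidPDE.seregin2019_localWeakL3_epsRegularity`
(`Seregin2019LocalWeakL3.lean`; G. Seregin, arXiv:1906.06707 = St. Petersburg Math. J. 32 (2021)
565–576, §4). No Navier–Stokes regularity statement is proved here.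

In §4 (p. 8) the limit `u` of the rescaled velocities (`u^k → u` in `L₃(Q(R))` for any `R > 0`)
inherits two slice-wise properties of the sequence: the class bound
`‖u‖_{L_∞(-∞,0;L^{3,∞}(ℝ³))} ≤ M` and the vanishing of the top slice `u(x,0) = 0` ("The latter
identity follows from the known inequality …"). This file proves both passages for a general
sequence `v_k → w` in `L³(Q(a))`, `Q(a) = ]-a²,0[ × B(a)`, for every `a > 0` — the form delivered
by the tree's compactness theorem on expanding balls (`LocalTypeIBlowup.local_suitableCompactness`)
— with the slice statements in the shape consumed by `Seregin2019.exists_restart_weakL3`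
(`Seregin2019WeakL3AncientLiouville.lean`):

* `Seregin2019.ae_weakL3_slices_of_tendsto` — if, for every `a`, eventually in `k` the slices
  `v_k(s)`, `s ∈ ]-a²,0[`, satisfy `t³ |{y ∈ B(a) : t < |v_k(s,y)|}| ≤ M³` for all `t > 0`, then
  for a.e. `s < 0` the slice `w(s)` is a.e.-strongly measurable with `sup_t t³|{t < |w(s)|}| ≤ 64 M³`
  (convergence in measure on `Q(a)`, sections of the superlevel sets — the constant is immaterial
  downstream);
* `Seregin2019.top_vanishing_of_tendsto` — if for every test field `φ` and `ε > 0` there is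
  `s₁ < 0` such that eventually in `k`, `|∫ ⟪v_k(s), φ⟫| ≤ ε` for a.e. `s ∈ ]s₁,0[`, then the same
  holds for `w` (the pairings converge in `L¹(]s₁,0[)`, hence a.e. along a subsequence).

## References

* G. Seregin, arXiv:1906.06707 (2019), §4 p. 8 (properties of the limit `u`:
  `‖u‖_{L_∞(-∞,0;L^{3,∞})} ≤ M`, `u(x,0) = 0`). [`Seregin2019`]
-/

noncomputable section

open MeasureTheory Set Function Filter Topology TopologicalSpace Metric
open scoped NNReal ENNReal InnerProductSpace RealInnerProductSpace

namespace Literature.Analysis.FluidPDE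

namespace Seregin2019

open Literature.Analysis.FunctionSpaces

variable {v : ℕ → ℝ → EuclideanSpace ℝ (Fin 3) → EuclideanSpace ℝ (Fin 3)}
  {w : ℝ → EuclideanSpace ℝ (Fin 3) → EuclideanSpace ℝ (Fin 3)}

/-! ### Weak-`L³` slices of the limit -/

/-- `sup_{t>0} t³ μ{|f| > t} ≤ W` from the bound at every real height, any measure. [folklore] -/
private theorem eWeakLpPow_three_le_of_forall_real {α : Type*} [MeasurableSpace α] {μ : Measure α}
    {E : Type*} [NormedAddCommGroup E] {f : α → E} {W : ℝ≥0∞}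
    (h : ∀ σ : ℝ, 0 < σ → ENNReal.ofReal (σ ^ 3) * μ {x | σ < ‖f x‖} ≤ W) :
    eWeakLpPow f 3 μ ≤ W := by
  unfold eWeakLpPow
  refine iSup_le fun t => ?_
  rcases eq_or_ne t 0 with rfl | ht
  · rw [ENNReal.coe_zero, ENNReal.toReal_ofNat, ENNReal.zero_rpow_of_pos (by norm_num), zero_mul]
    exact bot_le
  have htpos : (0 : ℝ) < t := lt_of_le_of_ne t.coe_nonneg fun h0 => ht (by exact_mod_cast h0.symm)
  have e1 : ((t : ℝ≥0∞)) ^ (3 : ℝ≥0∞).toReal = ENNReal.ofReal ((t : ℝ) ^ 3) := by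
    rw [ENNReal.toReal_ofNat, show ((3 : ℝ)) = ((3 : ℕ) : ℝ) by norm_num, ENNReal.rpow_natCast,
      ENNReal.ofReal_pow t.coe_nonneg, ENNReal.ofReal_coe_nnreal]
  have e2 : {x | (t : ℝ≥0∞) < ‖f x‖ₑ} = {x | (t : ℝ) < ‖f x‖} := by
    ext x
    simp only [mem_setOf_eq]
    rw [← ofReal_norm, ← ENNReal.ofReal_coe_nnreal, ENNReal.ofReal_lt_ofReal_iff_of_nonneg t.coe_nonneg]
  rw [e1, e2]
  exact h t htpos

/-- **Weak-`L³` slices pass to strong `L³(Q(a))` limits, on one ball.** If `v_k → w` in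
`L³(Q(a))` (all jointly a.e.-strongly measurable there) and, eventually in `k`, every slice
`v_k(s)`, `s ∈ ]-a²,0[`, satisfies `t³ |{y ∈ B(a) : t < |v_k(s,y)|}| ≤ M³` for all `t > 0`, then
for a.e. `s ∈ ]-a²,0[` and every `t > 0`, `t³ |{y ∈ B(a) : t < |w(s,y)|}| ≤ 64 M³`.
[cite: Seregin2019, §4 p. 8 (the limit keeps the L^{3,∞} bound)] -/
theorem ae_superlevel_slice_le_of_tendsto {a : ℝ} {M : ℝ}
    (hvm : ∀ᶠ k in atTop, AEStronglyMeasurable (uncurry (v k))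
      (volume.restrict (parabolicCylinder a (0 : ℝ × EuclideanSpace ℝ (Fin 3)))))
    (hwm : AEStronglyMeasurable (uncurry w)
      (volume.restrict (parabolicCylinder a (0 : ℝ × EuclideanSpace ℝ (Fin 3)))))
    (hconv : Tendsto (fun k => eLpNorm (uncurry (v k) - uncurry w) 3
      (volume.restrict (parabolicCylinder a (0 : ℝ × EuclideanSpace ℝ (Fin 3))))) atTop (𝓝 0))
    (hslice : ∀ᶠ k in atTop, ∀ s ∈ Ioo (-a ^ 2) (0 : ℝ), ∀ t : ℝ, 0 < t →
      ENNReal.ofReal (t ^ 3) *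
        (volume.restrict (ball (0 : EuclideanSpace ℝ (Fin 3)) a)) {y | t < ‖v k s y‖} ≤
        ENNReal.ofReal (M ^ 3)) :
    ∀ᵐ s ∂(volume.restrict (Ioo (-a ^ 2) (0 : ℝ))), ∀ t : ℝ, 0 < t →
      ENNReal.ofReal (t ^ 3) *
        (volume.restrict (ball (0 : EuclideanSpace ℝ (Fin 3)) a)) {y | t < ‖w s y‖} ≤
        64 * ENNReal.ofReal (M ^ 3) := by
  -- ## the cylinder as a product
  set I : Set ℝ := Ioo (-a ^ 2) 0 with hI
  set B : Set (EuclideanSpace ℝ (Fin 3)) := ball 0 a with hB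
  set μ : Measure (ℝ × EuclideanSpace ℝ (Fin 3)) :=
    volume.restrict (parabolicCylinder a (0 : ℝ × EuclideanSpace ℝ (Fin 3))) with hμ
  have hQ : parabolicCylinder a (0 : ℝ × EuclideanSpace ℝ (Fin 3)) = I ×ˢ B :=
    SuitableCompactness.parabolicCylinder_zero a
  have hprod : μ = (volume.restrict I).prod (volume.restrict B) := by
    rw [hμ, hQ, Measure.volume_eq_prod, Measure.prod_restrict]
  haveI : IsFiniteMeasure (volume.restrict B) := isFiniteMeasure_restrict.2 measure_ball_lt_top.ne
  -- ## pass to a tail where everything holds, and to measurable representatives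
  obtain ⟨k₀, hk₀⟩ : ∃ k₀, ∀ k, k₀ ≤ k → AEStronglyMeasurable (uncurry (v k)) μ ∧
      ∀ s ∈ I, ∀ t : ℝ, 0 < t → ENNReal.ofReal (t ^ 3) *
        (volume.restrict B) {y | t < ‖v k s y‖} ≤ ENNReal.ofReal (M ^ 3) := by
    obtain ⟨k₀, hk₀⟩ := eventually_atTop.1 (hvm.and hslice)
    exact ⟨k₀, hk₀⟩
  set wt : ℝ × EuclideanSpace ℝ (Fin 3) → EuclideanSpace ℝ (Fin 3) := hwm.mk (uncurry w) with hwt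
  have hwtm : StronglyMeasurable wt := hwm.stronglyMeasurable_mk
  have hwwt : uncurry w =ᵐ[μ] wt := hwm.ae_eq_mk
  set vt : ℕ → ℝ × EuclideanSpace ℝ (Fin 3) → EuclideanSpace ℝ (Fin 3) := fun k =>
    if hk : k₀ ≤ k then (hk₀ k hk).1.mk (uncurry (v k)) else 0 with hvt
  have hvtm : ∀ k, StronglyMeasurable (vt k) := by
    intro k
    by_cases hk : k₀ ≤ k
    · simp only [hvt, dif_pos hk]; exact (hk₀ k hk).1.stronglyMeasurable_mk
    · simp only [hvt, dif_neg hk]; exact stronglyMeasurable_const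
  have hvvt : ∀ k, k₀ ≤ k → uncurry (v k) =ᵐ[μ] vt k := by
    intro k hk
    simp only [hvt, dif_pos hk]
    exact (hk₀ k hk).1.ae_eq_mk
  -- slices of the representatives agree a.e. with the slices
  have hwslice : ∀ᵐ s ∂(volume.restrict I), (fun y => wt (s, y)) =ᵐ[volume.restrict B] w s := by
    have h1 : ∀ᵐ z ∂((volume.restrict I).prod (volume.restrict B)), uncurry w z = wt z := by
      rw [← hprod]; exact hwwt
    filter_upwards [Measure.ae_ae_of_ae_prod h1] with s hs
    filter_upwards [hs] with y hy
    exact hy.symm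
  have hvslice : ∀ k, k₀ ≤ k → ∀ᵐ s ∂(volume.restrict I),
      (fun y => vt k (s, y)) =ᵐ[volume.restrict B] v k s := by
    intro k hk
    have h1 : ∀ᵐ z ∂((volume.restrict I).prod (volume.restrict B)), uncurry (v k) z = vt k z := by
      rw [← hprod]; exact hvvt k hk
    filter_upwards [Measure.ae_ae_of_ae_prod h1] with s hs
    filter_upwards [hs] with y hy
    exact hy.symm
  -- ## the bound on sections of the superlevel sets of `wt`, for one rational height
  have hkey : ∀ q : ℚ, (0 : ℝ) < q → ∀ᵐ s ∂(volume.restrict I),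
      (volume.restrict B) {y | (q : ℝ) < ‖wt (s, y)‖} ≤
        ENNReal.ofReal ((q : ℝ) ^ 3)⁻¹ * (8 * ENNReal.ofReal (M ^ 3)) := by
    intro q hq
    set t : ℝ := (q : ℝ) with ht
    -- the superlevel set and its sections
    set A : Set (ℝ × EuclideanSpace ℝ (Fin 3)) := {z | t < ‖wt z‖} with hA
    have hAm : MeasurableSet A := measurableSet_lt measurable_const hwtm.measurable.norm
    set f : ℝ → ℝ≥0∞ := fun s => (volume.restrict B) (Prod.mk s ⁻¹' A) with hf
    have hfm : Measurable f := measurable_measure_prodMk_left hAm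
    have hfs : ∀ s, f s = (volume.restrict B) {y | t < ‖wt (s, y)‖} := fun s => rfl
    set C : ℝ≥0∞ := ENNReal.ofReal (t ^ 3)⁻¹ * (8 * ENNReal.ofReal (M ^ 3)) with hC
    -- `∫_S f ≤ C |S|` for every measurable `S`
    have hS : ∀ S : Set ℝ, MeasurableSet S → (volume.restrict I) S < ⊤ →
        ∫⁻ s in S, f s ∂(volume.restrict I) ≤ ∫⁻ s in S, C ∂(volume.restrict I) := by
      intro S hSm _
      rw [lintegral_const, Measure.restrict_apply_univ]
      -- `μ(A ∩ (S × univ)) = ∫_S f`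
      have hAS : ∫⁻ s in S, f s ∂(volume.restrict I) = μ (A ∩ S ×ˢ (univ : Set (EuclideanSpace ℝ (Fin 3)))) := by
        rw [hprod, Measure.prod_apply (hAm.inter (hSm.prod MeasurableSet.univ))]
        rw [← lintegral_indicator hSm]
        refine lintegral_congr fun s => ?_
        by_cases hs : s ∈ S
        · rw [indicator_of_mem hs]
          have e : Prod.mk s ⁻¹' (A ∩ S ×ˢ (univ : Set (EuclideanSpace ℝ (Fin 3)))) = Prod.mk s ⁻¹' A := by
            ext y; simp [hs]
          rw [e]
        · rw [indicator_of_notMem hs]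
          have : Prod.mk s ⁻¹' (A ∩ S ×ˢ (univ : Set (EuclideanSpace ℝ (Fin 3)))) = ∅ := by
            ext y; simp [hs]
          rw [this, measure_empty]
      rw [hAS]
      -- comparison with the approximants: `A ⊆ {t/2 < |vt k|} ∪ {t/2 ≤ |vt k - wt|}`
      have hincl : ∀ k, A ∩ S ×ˢ (univ : Set (EuclideanSpace ℝ (Fin 3))) ⊆
          ({z | t / 2 < ‖vt k z‖} ∩ S ×ˢ (univ : Set (EuclideanSpace ℝ (Fin 3)))) ∪
            {z | ENNReal.ofReal (t / 2) ≤ ‖(vt k - wt) z‖ₑ} := by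
        intro k z hz
        obtain ⟨hzA, hzS⟩ := hz
        have hzA' : t < ‖wt z‖ := hzA
        by_cases h1 : t / 2 < ‖vt k z‖
        · exact Or.inl ⟨h1, hzS⟩
        · refine Or.inr ?_
          have h2 : t / 2 ≤ ‖vt k z - wt z‖ := by
            have := norm_sub_norm_le (wt z) (vt k z)
            rw [norm_sub_rev] at this
            linarith [not_lt.1 h1]
          show ENNReal.ofReal (t / 2) ≤ ‖(vt k - wt) z‖ₑ
          rw [Pi.sub_apply, ← ofReal_norm]
          exact ENNReal.ofReal_le_ofReal h2
      -- the first set: sections bounded by the slice hypothesis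
      have hfirst : ∀ k, k₀ ≤ k → μ ({z | t / 2 < ‖vt k z‖} ∩ S ×ˢ (univ : Set (EuclideanSpace ℝ (Fin 3)))) ≤
          C * (volume.restrict I) S := by
        intro k hk
        have hAk : MeasurableSet ({z : ℝ × EuclideanSpace ℝ (Fin 3) | t / 2 < ‖vt k z‖}) :=
          measurableSet_lt measurable_const (hvtm k).measurable.norm
        rw [hprod, Measure.prod_apply (hAk.inter (hSm.prod MeasurableSet.univ))]
        have hsec : ∀ᵐ s ∂(volume.restrict I), (volume.restrict B)
            (Prod.mk s ⁻¹' ({z : ℝ × EuclideanSpace ℝ (Fin 3) | t / 2 < ‖vt k z‖} ∩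
              S ×ˢ (univ : Set (EuclideanSpace ℝ (Fin 3))))) ≤ S.indicator (fun _ => C) s := by
          filter_upwards [hvslice k hk, ae_restrict_mem measurableSet_Ioo] with s hs hsI
          by_cases hsS : s ∈ S
          · rw [indicator_of_mem hsS]
            have e1 : Prod.mk s ⁻¹' ({z : ℝ × EuclideanSpace ℝ (Fin 3) | t / 2 < ‖vt k z‖} ∩
                S ×ˢ (univ : Set (EuclideanSpace ℝ (Fin 3)))) = {y | t / 2 < ‖vt k (s, y)‖} := by
              ext y; simp [hsS]
            rw [e1, measure_congr (show {y | t / 2 < ‖vt k (s, y)‖} =ᵐ[volume.restrict B]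
              {y | t / 2 < ‖v k s y‖} from hs.mono fun y hy => by
                have hy' : vt k (s, y) = v k s y := hy
                show (t / 2 < ‖vt k (s, y)‖) = (t / 2 < ‖v k s y‖)
                rw [hy'])]
            have h3 := (hk₀ k hk).2 s hsI (t / 2) (by positivity)
            -- `μ ≤ (t/2)⁻³ M³ = 8 t⁻³ M³`
            have ht2 : ENNReal.ofReal ((t / 2) ^ 3) ≠ 0 := (ENNReal.ofReal_pos.2 (by positivity)).ne'
            calc (volume.restrict B) {y | t / 2 < ‖v k s y‖}
                = (ENNReal.ofReal ((t / 2) ^ 3))⁻¹ * (ENNReal.ofReal ((t / 2) ^ 3) *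
                    (volume.restrict B) {y | t / 2 < ‖v k s y‖}) := by
                  rw [← mul_assoc, ENNReal.inv_mul_cancel ht2 ENNReal.ofReal_ne_top, one_mul]
              _ ≤ (ENNReal.ofReal ((t / 2) ^ 3))⁻¹ * ENNReal.ofReal (M ^ 3) := by gcongr
              _ = C := by
                  rw [hC, ← mul_assoc]
                  congr 1
                  have e8 : (8 : ℝ≥0∞) = ENNReal.ofReal 8 := by norm_num
                  rw [e8, ← ENNReal.ofReal_inv_of_pos (by positivity), ← ENNReal.ofReal_mul (by positivity)]
                  congr 1
                  field_simp
                  ring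
          · rw [indicator_of_notMem hsS]
            have : Prod.mk s ⁻¹' ({z : ℝ × EuclideanSpace ℝ (Fin 3) | t / 2 < ‖vt k z‖} ∩
                S ×ˢ (univ : Set (EuclideanSpace ℝ (Fin 3)))) = ∅ := by
              ext y; simp [hsS]
            rw [this, measure_empty]
        refine (lintegral_mono_ae hsec).trans ?_
        rw [lintegral_indicator hSm, setLIntegral_const]
      -- the second set: Chebyshev and the `L³` convergence
      have hsecond : Tendsto (fun k => μ {z | ENNReal.ofReal (t / 2) ≤ ‖(vt k - wt) z‖ₑ}) atTop (𝓝 0) := by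
        have hconv' : Tendsto (fun k => eLpNorm (vt k - wt) 3 μ) atTop (𝓝 0) := by
          refine hconv.congr' ?_
          filter_upwards [eventually_ge_atTop k₀] with k hk
          exact eLpNorm_congr_ae ((hvvt k hk).sub hwwt)
        have hb : ∀ k, μ {z | ENNReal.ofReal (t / 2) ≤ ‖(vt k - wt) z‖ₑ} ≤
            (ENNReal.ofReal (t / 2))⁻¹ ^ (3 : ℝ) * eLpNorm (vt k - wt) 3 μ ^ (3 : ℝ) := by
          intro k
          have h := mul_meas_ge_le_pow_eLpNorm' (p := 3) μ (by norm_num : (3 : ℝ≥0∞) ≠ 0)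
            (by norm_num : (3 : ℝ≥0∞) ≠ ⊤) ((hvtm k).sub hwtm).aestronglyMeasurable (ENNReal.ofReal (t / 2))
          rw [ENNReal.toReal_ofNat] at h
          have hne : ENNReal.ofReal (t / 2) ^ (3 : ℝ) ≠ 0 :=
            (ENNReal.rpow_pos (ENNReal.ofReal_pos.2 (by positivity)) ENNReal.ofReal_ne_top).ne'
          calc μ {z | ENNReal.ofReal (t / 2) ≤ ‖(vt k - wt) z‖ₑ}
              = (ENNReal.ofReal (t / 2) ^ (3 : ℝ))⁻¹ * (ENNReal.ofReal (t / 2) ^ (3 : ℝ) *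
                  μ {z | ENNReal.ofReal (t / 2) ≤ ‖(vt k - wt) z‖ₑ}) := by
                rw [← mul_assoc, ENNReal.inv_mul_cancel hne
                  (ENNReal.rpow_ne_top_of_nonneg (by norm_num) ENNReal.ofReal_ne_top), one_mul]
            _ ≤ (ENNReal.ofReal (t / 2) ^ (3 : ℝ))⁻¹ * eLpNorm (vt k - wt) 3 μ ^ (3 : ℝ) := by gcongr
            _ = (ENNReal.ofReal (t / 2))⁻¹ ^ (3 : ℝ) * eLpNorm (vt k - wt) 3 μ ^ (3 : ℝ) := by
                rw [ENNReal.inv_rpow]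
        have hlim : Tendsto (fun k => (ENNReal.ofReal (t / 2))⁻¹ ^ (3 : ℝ) * eLpNorm (vt k - wt) 3 μ ^ (3 : ℝ))
            atTop (𝓝 0) := by
          have h1 : Tendsto (fun k => eLpNorm (vt k - wt) 3 μ ^ (3 : ℝ)) atTop (𝓝 0) := by
            have := ((ENNReal.continuous_rpow_const (y := (3 : ℝ))).tendsto 0).comp hconv'
            rwa [ENNReal.zero_rpow_of_pos (by norm_num : (0 : ℝ) < 3)] at this
          have hne3 : (ENNReal.ofReal (t / 2))⁻¹ ^ (3 : ℝ) ≠ ⊤ :=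
            ENNReal.rpow_ne_top_of_nonneg (by norm_num : (0 : ℝ) ≤ 3)
              (ENNReal.inv_ne_top.2 (ENNReal.ofReal_pos.2 (by positivity : (0 : ℝ) < t / 2)).ne')
          have h2 := ENNReal.Tendsto.const_mul h1 (Or.inr hne3)
          rwa [mul_zero] at h2
        exact tendsto_of_tendsto_of_tendsto_of_le_of_le tendsto_const_nhds hlim (fun _ => bot_le) hb
      -- conclusion: `μ(A ∩ S×univ) ≤ C |S| + o(1)`
      have hle : ∀ k, k₀ ≤ k → μ (A ∩ S ×ˢ (univ : Set (EuclideanSpace ℝ (Fin 3)))) ≤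
          C * (volume.restrict I) S + μ {z | ENNReal.ofReal (t / 2) ≤ ‖(vt k - wt) z‖ₑ} := fun k hk =>
        (measure_mono (hincl k)).trans ((measure_union_le _ _).trans (add_le_add (hfirst k hk) le_rfl))
      have hlim2 : Tendsto (fun k => C * (volume.restrict I) S +
          μ {z | ENNReal.ofReal (t / 2) ≤ ‖(vt k - wt) z‖ₑ}) atTop (𝓝 (C * (volume.restrict I) S)) := by
        have := hsecond.const_add (C * (volume.restrict I) S)
        rwa [add_zero] at this
      exact ge_of_tendsto hlim2 (eventually_atTop.2 ⟨k₀, hle⟩)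
    have hae := ae_le_of_forall_setLIntegral_le_of_sigmaFinite hfm hS
    filter_upwards [hae] with s hs
    rw [hfs s] at hs
    exact hs
  -- ## all rational heights at once, and back to `w`
  have hall : ∀ᵐ s ∂(volume.restrict I), ∀ q : ℚ, (0 : ℝ) < q →
      (volume.restrict B) {y | (q : ℝ) < ‖wt (s, y)‖} ≤
        ENNReal.ofReal ((q : ℝ) ^ 3)⁻¹ * (8 * ENNReal.ofReal (M ^ 3)) := by
    rw [ae_all_iff]
    intro q
    by_cases hq : (0 : ℝ) < q
    · filter_upwards [hkey q hq] with s hs _ using hs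
    · exact Eventually.of_forall fun s h => absurd h hq
  filter_upwards [hall, hwslice] with s hs hsw t ht
  -- a rational height `q ∈ [t/2, t)`
  obtain ⟨q, hq1, hq2⟩ := exists_rat_btwn (by linarith : t / 2 < t)
  have hqpos : (0 : ℝ) < q := lt_trans (by positivity) hq1
  have hsub : {y | t < ‖w s y‖} ⊆ {y | (q : ℝ) < ‖w s y‖} := fun y hy => lt_trans hq2 hy
  have e1 : (volume.restrict B) {y | (q : ℝ) < ‖w s y‖} = (volume.restrict B) {y | (q : ℝ) < ‖wt (s, y)‖} :=
    measure_congr (hsw.mono fun y hy => by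
      have hy' : wt (s, y) = w s y := hy
      show ((q : ℝ) < ‖w s y‖) = ((q : ℝ) < ‖wt (s, y)‖)
      rw [hy'])
  calc ENNReal.ofReal (t ^ 3) * (volume.restrict B) {y | t < ‖w s y‖}
      ≤ ENNReal.ofReal (t ^ 3) * (volume.restrict B) {y | (q : ℝ) < ‖wt (s, y)‖} := by
        rw [← e1]; gcongr
    _ ≤ ENNReal.ofReal (t ^ 3) * (ENNReal.ofReal ((q : ℝ) ^ 3)⁻¹ * (8 * ENNReal.ofReal (M ^ 3))) := by
        gcongr; exact hs q hqpos
    _ = ENNReal.ofReal (t ^ 3 * ((q : ℝ) ^ 3)⁻¹ * 8) * ENNReal.ofReal (M ^ 3) := by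
        rw [← mul_assoc, ← mul_assoc, ← ENNReal.ofReal_mul (by positivity)]
        congr 1
        rw [show (8 : ℝ≥0∞) = ENNReal.ofReal 8 by norm_num, ← ENNReal.ofReal_mul (by positivity)]
    _ ≤ ENNReal.ofReal 64 * ENNReal.ofReal (M ^ 3) := by
        gcongr
        -- `t³ q⁻³ 8 ≤ 64` since `t ≤ 2q`
        have hq3 : (0 : ℝ) < (q : ℝ) ^ 3 := by positivity
        have h2q : t ≤ 2 * q := by linarith
        calc t ^ 3 * ((q : ℝ) ^ 3)⁻¹ * 8 = (t ^ 3 / (q : ℝ) ^ 3) * 8 := by rw [div_eq_mul_inv]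
          _ ≤ (2 : ℝ) ^ 3 * 8 := by
              gcongr
              rw [div_le_iff₀ hq3]
              calc t ^ 3 ≤ (2 * q) ^ 3 := by gcongr
                _ = 2 ^ 3 * (q : ℝ) ^ 3 := by ring
          _ = 64 := by norm_num
    _ = 64 * ENNReal.ofReal (M ^ 3) := by norm_num

/-- The slices of a field which is jointly a.e.-strongly measurable on `Q(a)` are a.e.-strongly
measurable on `B(a)` for a.e. `s ∈ ]-a²,0[`. [folklore] -/
private theorem ae_aestronglyMeasurable_slice {a : ℝ}
    (hwm : AEStronglyMeasurable (uncurry w)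
      (volume.restrict (parabolicCylinder a (0 : ℝ × EuclideanSpace ℝ (Fin 3))))) :
    ∀ᵐ s ∂(volume.restrict (Ioo (-a ^ 2) (0 : ℝ))),
      AEStronglyMeasurable (w s) (volume.restrict (ball (0 : EuclideanSpace ℝ (Fin 3)) a)) := by
  have hprod : (volume.restrict (parabolicCylinder a (0 : ℝ × EuclideanSpace ℝ (Fin 3))) :
      Measure (ℝ × EuclideanSpace ℝ (Fin 3))) =
      (volume.restrict (Ioo (-a ^ 2) (0 : ℝ))).prod
        (volume.restrict (ball (0 : EuclideanSpace ℝ (Fin 3)) a)) := by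
    rw [SuitableCompactness.parabolicCylinder_zero, Measure.volume_eq_prod, Measure.prod_restrict]
  rw [hprod] at hwm
  filter_upwards [hwm.prodMk_left] with s hs
  exact hs

/-- **The limit has weak-`L³` slices** (Seregin 2019, §4 p. 8: the limit `u` of the rescaled
velocities satisfies `‖u‖_{L_∞(-∞,0;L^{3,∞}(ℝ³))} ≤ M`). If `v_k → w` in `L³(Q(a))` for every
`a > 0` and, for every `a`, eventually in `k` the slices `v_k(s)`, `s ∈ ]-a²,0[`, satisfy
`t³ |{y ∈ B(a) : t < |v_k(s,y)|}| ≤ M³` (`t > 0`), then for a.e. `s < 0` the slice `w(s)` is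
a.e.-strongly measurable and weak-`L³` on `ℝ³` with `sup_t t³ |{t < |w(s)|}| ≤ 64 M³`.
[cite: Seregin2019, §4 p. 8 (the limit keeps the L^{3,∞} bound)] -/
theorem ae_weakL3_slices_of_tendsto {M : ℝ}
    (hvm : ∀ a : ℝ, 0 < a → ∀ᶠ k in atTop, AEStronglyMeasurable (uncurry (v k))
      (volume.restrict (parabolicCylinder a (0 : ℝ × EuclideanSpace ℝ (Fin 3)))))
    (hwm : ∀ a : ℝ, 0 < a → AEStronglyMeasurable (uncurry w)
      (volume.restrict (parabolicCylinder a (0 : ℝ × EuclideanSpace ℝ (Fin 3)))))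
    (hconv : ∀ a : ℝ, 0 < a → Tendsto (fun k => eLpNorm (uncurry (v k) - uncurry w) 3
      (volume.restrict (parabolicCylinder a (0 : ℝ × EuclideanSpace ℝ (Fin 3))))) atTop (𝓝 0))
    (hslice : ∀ a : ℝ, 0 < a → ∀ᶠ k in atTop, ∀ s ∈ Ioo (-a ^ 2) (0 : ℝ), ∀ t : ℝ, 0 < t →
      ENNReal.ofReal (t ^ 3) *
        (volume.restrict (ball (0 : EuclideanSpace ℝ (Fin 3)) a)) {y | t < ‖v k s y‖} ≤
        ENNReal.ofReal (M ^ 3)) :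
    ∀ᵐ s ∂(volume.restrict (Iio (0 : ℝ))),
      AEStronglyMeasurable (w s) volume ∧ eWeakLpPow (w s) 3 volume ≤ 64 * ENNReal.ofReal (M ^ 3) := by
  -- the statements on the balls `B(n+1)`, for all `n` at once
  have hn : ∀ n : ℕ, ∀ᵐ s ∂(volume : Measure ℝ), s ∈ Ioo (-((n : ℝ) + 1) ^ 2) 0 →
      AEStronglyMeasurable (w s) (volume.restrict (ball (0 : EuclideanSpace ℝ (Fin 3)) ((n : ℝ) + 1))) ∧
      ∀ t : ℝ, 0 < t → ENNReal.ofReal (t ^ 3) *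
        (volume.restrict (ball (0 : EuclideanSpace ℝ (Fin 3)) ((n : ℝ) + 1))) {y | t < ‖w s y‖} ≤
        64 * ENNReal.ofReal (M ^ 3) := by
    intro n
    have ha : (0 : ℝ) < (n : ℝ) + 1 := by positivity
    have h1 := ae_aestronglyMeasurable_slice (hwm _ ha)
    have h2 := ae_superlevel_slice_le_of_tendsto (hvm _ ha) (hwm _ ha) (hconv _ ha) (hslice _ ha)
    exact (ae_restrict_iff' measurableSet_Ioo).1 (h1.and h2)
  have hall := ae_all_iff.2 hn
  refine (ae_restrict_iff' measurableSet_Iio).2 ?_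
  filter_upwards [hall] with s hs hs0
  have hs0' : s < 0 := hs0
  -- an index `n₀` with `-(n₀+1)² < s`
  obtain ⟨n₀, hn₀⟩ := exists_nat_gt (-s)
  have hmem : ∀ n : ℕ, s ∈ Ioo (-(((n + n₀ : ℕ) : ℝ) + 1) ^ 2) 0 := by
    intro n
    refine ⟨?_, hs0'⟩
    have h1 : (1 : ℝ) ≤ ((n + n₀ : ℕ) : ℝ) + 1 := by
      have := (n + n₀).cast_nonneg (α := ℝ); linarith
    have h2 : -s < ((n + n₀ : ℕ) : ℝ) + 1 := by
      have := n.cast_nonneg (α := ℝ); push_cast; linarith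
    nlinarith
  -- the balls `B(n + n₀ + 1)` exhaust space
  set Bn : ℕ → Set (EuclideanSpace ℝ (Fin 3)) := fun n => ball 0 ((((n + n₀ : ℕ) : ℝ)) + 1) with hBn
  have hmono : Monotone Bn := by
    intro m n hmn
    refine Metric.ball_subset_ball ?_
    have : ((m + n₀ : ℕ) : ℝ) ≤ ((n + n₀ : ℕ) : ℝ) := by exact_mod_cast Nat.add_le_add_right hmn n₀
    linarith
  have hU : (⋃ n, Bn n) = univ := by
    refine eq_univ_of_forall fun y => mem_iUnion.2 ?_
    obtain ⟨n, hn'⟩ := exists_nat_gt ‖y‖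
    refine ⟨n, ?_⟩
    rw [hBn, mem_ball, dist_zero_right]
    have := n₀.cast_nonneg (α := ℝ)
    push_cast
    linarith
  refine ⟨?_, ?_⟩
  · -- measurability on `ℝ³ = ⋃ B(n + n₀ + 1)`
    rw [← Measure.restrict_univ (μ := (volume : Measure (EuclideanSpace ℝ (Fin 3)))), ← hU,
      aestronglyMeasurable_iUnion_iff]
    intro n
    exact (hs (n + n₀) (hmem n)).1
  · -- the weak quasinorm: every superlevel set is exhausted by the balls
    refine eWeakLpPow_three_le_of_forall_real fun σ hσ => ?_
    have hlev : volume {y | σ < ‖w s y‖} = ⨆ n, (volume.restrict (Bn n)) {y | σ < ‖w s y‖} := by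
      have e : ∀ n, (volume.restrict (Bn n)) {y | σ < ‖w s y‖} = volume ({y | σ < ‖w s y‖} ∩ Bn n) :=
        fun n => Measure.restrict_apply' measurableSet_ball
      simp_rw [e]
      have hmono' : Monotone fun n => {y | σ < ‖w s y‖} ∩ Bn n :=
        fun m n hmn => inter_subset_inter_right _ (hmono hmn)
      rw [← hmono'.measure_iUnion, ← inter_iUnion, hU, inter_univ]
    rw [hlev, ENNReal.mul_iSup]
    exact iSup_le fun n => (hs (n + n₀) (hmem n)).2 σ hσ

/-! ### The pairings at the top time -/

/-- **Vanishing of the top pairings passes to strong `L³(Q(a))` limits** (Seregin 2019, §4 p. 8: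
`u(x,0) = 0` for the limit). If `v_k → w` in `L³(Q(a))` for every `a > 0`, `w ∈ L³(Q(a))`, and for
every test field `φ` and `ε > 0` there is `s₁ < 0` such that, eventually in `k`,
`|∫ ⟪v_k(s), φ⟫| ≤ ε` for a.e. `s ∈ ]s₁,0[`, then the same holds for `w`: the pairings converge
in `L¹(]s₁,0[)`, hence a.e. along a subsequence. [cite: Seregin2019, §4 p. 8 (u(x,0) = 0 for the limit)] -/
theorem top_vanishing_of_tendsto
    (hvm : ∀ a : ℝ, 0 < a → ∀ᶠ k in atTop, AEStronglyMeasurable (uncurry (v k))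
      (volume.restrict (parabolicCylinder a (0 : ℝ × EuclideanSpace ℝ (Fin 3)))))
    (hw3 : ∀ a : ℝ, 0 < a → MemLp (uncurry w) 3
      (volume.restrict (parabolicCylinder a (0 : ℝ × EuclideanSpace ℝ (Fin 3)))))
    (hconv : ∀ a : ℝ, 0 < a → Tendsto (fun k => eLpNorm (uncurry (v k) - uncurry w) 3
      (volume.restrict (parabolicCylinder a (0 : ℝ × EuclideanSpace ℝ (Fin 3))))) atTop (𝓝 0))
    (hsmall : ∀ φ : EuclideanSpace ℝ (Fin 3) → EuclideanSpace ℝ (Fin 3), ContDiff ℝ (⊤ : ℕ∞) φ →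
      HasCompactSupport φ → ∀ ε : ℝ, 0 < ε → ∃ s₁ : ℝ, s₁ < 0 ∧ ∀ᶠ k in atTop,
        ∀ᵐ s ∂(volume.restrict (Ioo s₁ 0)), |∫ y, ⟪v k s y, φ y⟫| ≤ ε)
    {φ : EuclideanSpace ℝ (Fin 3) → EuclideanSpace ℝ (Fin 3)} (hφ : ContDiff ℝ (⊤ : ℕ∞) φ)
    (hφc : HasCompactSupport φ) {ε : ℝ} (hε : 0 < ε) :
    ∃ s₁ : ℝ, s₁ < 0 ∧ ∀ᵐ s ∂(volume.restrict (Ioo s₁ 0)), |∫ y, ⟪w s y, φ y⟫| ≤ ε := by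
  obtain ⟨s₁, hs₁, hev⟩ := hsmall φ hφ hφc ε hε
  refine ⟨s₁, hs₁, ?_⟩
  -- ## a ball `Q(a)` carrying the support of `φ` and the time window
  obtain ⟨r, hr⟩ := hφc.isCompact.isBounded.subset_closedBall (0 : EuclideanSpace ℝ (Fin 3))
  obtain ⟨a, ha1, har, has⟩ : ∃ a : ℝ, 1 ≤ a ∧ r < a ∧ -a ^ 2 ≤ s₁ := by
    have h0 := le_max_right r 0
    have h0' := le_max_left r 0
    refine ⟨max r 0 + 1 - s₁, by linarith, by linarith, ?_⟩
    have h1 : (1 : ℝ) ≤ max r 0 + 1 - s₁ := by linarith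
    have h2 : -s₁ ≤ max r 0 + 1 - s₁ := by linarith
    nlinarith
  have ha : 0 < a := by linarith
  set I : Set ℝ := Ioo (-a ^ 2) 0 with hI
  set B : Set (EuclideanSpace ℝ (Fin 3)) := ball 0 a with hB
  have hφB : tsupport φ ⊆ B := hr.trans (closedBall_subset_ball har)
  have hφ0 : ∀ y ∉ B, φ y = 0 := fun y hy => image_eq_zero_of_notMem_tsupport fun h => hy (hφB h)
  obtain ⟨Φ₀, hΦ₀⟩ : ∃ Φ₀ : ℝ, ∀ y, ‖φ y‖ ≤ Φ₀ :=
    hφ.continuous.bounded_above_of_compact_support hφc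
  -- ## the product structure
  set μ : Measure (ℝ × EuclideanSpace ℝ (Fin 3)) :=
    volume.restrict (parabolicCylinder a (0 : ℝ × EuclideanSpace ℝ (Fin 3))) with hμ
  have hprod : μ = (volume.restrict I).prod (volume.restrict B) := by
    rw [hμ, SuitableCompactness.parabolicCylinder_zero, Measure.volume_eq_prod, Measure.prod_restrict]
  haveI hBfin : IsFiniteMeasure (volume.restrict B) := isFiniteMeasure_restrict.2 measure_ball_lt_top.ne
  haveI hIfin : IsFiniteMeasure (volume.restrict I) := isFiniteMeasure_restrict.2 measure_Ioo_lt_top.ne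
  haveI : IsFiniteMeasure μ := by rw [hprod]; infer_instance
  -- ## the tail: measurable approximants in `L³(Q(a))`
  have hw := hw3 a ha
  obtain ⟨k₀, hk₀⟩ : ∃ k₀, ∀ k, k₀ ≤ k → AEStronglyMeasurable (uncurry (v k)) μ ∧
      eLpNorm (uncurry (v k) - uncurry w) 3 μ < 1 ∧
      ∀ᵐ s ∂(volume.restrict (Ioo s₁ 0)), |∫ y, ⟪v k s y, φ y⟫| ≤ ε := by
    have h2 : ∀ᶠ k in atTop, eLpNorm (uncurry (v k) - uncurry w) 3 μ < 1 :=
      (hconv a ha).eventually (gt_mem_nhds zero_lt_one)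
    obtain ⟨k₀, hk₀⟩ := eventually_atTop.1 (((hvm a ha).and h2).and hev)
    exact ⟨k₀, fun k hk => ⟨(hk₀ k hk).1.1, (hk₀ k hk).1.2, (hk₀ k hk).2⟩⟩
  have hdiff3 : ∀ k, k₀ ≤ k → MemLp (uncurry (v k) - uncurry w) 3 μ := fun k hk =>
    ⟨(hk₀ k hk).1.sub hw.1, (hk₀ k hk).2.1.trans ENNReal.one_lt_top⟩
  have hdiff1 : ∀ k, k₀ ≤ k → Integrable (uncurry (v k) - uncurry w) μ := fun k hk =>
    (hdiff3 k hk).integrable (by norm_num)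
  -- ## the pairings as functions of time
  set g : ℕ → ℝ → ℝ := fun k s => ∫ y, ⟪v k s y, φ y⟫ with hg
  set G : ℝ → ℝ := fun s => ∫ y, ⟪w s y, φ y⟫ with hG
  have hpairB : ∀ (u : EuclideanSpace ℝ (Fin 3) → EuclideanSpace ℝ (Fin 3)),
      ∫ y, ⟪u y, φ y⟫ = ∫ y in B, ⟪u y, φ y⟫ := fun u =>
    (setIntegral_eq_integral_of_forall_compl_eq_zero fun y hy => by
      rw [hφ0 y hy, inner_zero_right]).symm
  -- measurability in time
  have hmeas_pair : ∀ (U : ℝ × EuclideanSpace ℝ (Fin 3) → EuclideanSpace ℝ (Fin 3)),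
      AEStronglyMeasurable U μ →
      AEStronglyMeasurable (fun s => ∫ y in B, ⟪U (s, y), φ y⟫) (volume.restrict I) := by
    intro U hU
    have h1 : AEStronglyMeasurable (fun z : ℝ × EuclideanSpace ℝ (Fin 3) => ⟪U z, φ z.2⟫)
        ((volume.restrict I).prod (volume.restrict B)) := by
      rw [← hprod]
      exact hU.inner (hφ.continuous.comp_aestronglyMeasurable
        (measurable_snd.aestronglyMeasurable))
    exact h1.integral_prod_right'
  have hgm : ∀ k, k₀ ≤ k → AEStronglyMeasurable (g k) (volume.restrict I) := by
    intro k hk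
    have h := hmeas_pair (uncurry (v k)) (hk₀ k hk).1
    refine h.congr (Eventually.of_forall fun s => ?_)
    show ∫ y in B, ⟪v k s y, φ y⟫ = ∫ y, ⟪v k s y, φ y⟫
    rw [hpairB]
  have hGm : AEStronglyMeasurable G (volume.restrict I) := by
    have h := hmeas_pair (uncurry w) hw.1
    refine h.congr (Eventually.of_forall fun s => ?_)
    show ∫ y in B, ⟪w s y, φ y⟫ = ∫ y, ⟪w s y, φ y⟫
    rw [hpairB]
  -- ## `L¹` convergence of the pairings
  have hL1 : Tendsto (fun k => eLpNorm (g (k + k₀) - G) 1 (volume.restrict I)) atTop (𝓝 0) := by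
    -- pointwise a.e. bound by the sliced `L¹` norm
    have hbd : ∀ k, k₀ ≤ k → eLpNorm (g k - G) 1 (volume.restrict I) ≤
        ENNReal.ofReal Φ₀ * ∫⁻ z, ‖(uncurry (v k) - uncurry w) z‖ₑ ∂μ := by
      intro k hk
      have hint := hdiff1 k hk
      rw [hprod] at hint
      have hslice := hint.prod_right_ae
      rw [eLpNorm_one_eq_lintegral_enorm]
      have hpt : ∀ᵐ s ∂(volume.restrict I), ‖(g k - G) s‖ₑ ≤
          ∫⁻ y, ENNReal.ofReal Φ₀ * ‖(uncurry (v k) - uncurry w) (s, y)‖ₑ ∂(volume.restrict B) := by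
        -- slices of `v k` and `w` integrable on `B` for a.e. `s`
        have hvk3 : MemLp (uncurry (v k)) 3 μ := by
          have e : uncurry (v k) = (uncurry (v k) - uncurry w) + uncurry w := by abel
          rw [e]
          exact (hdiff3 k hk).add hw
        have hvk1 : Integrable (uncurry (v k)) ((volume.restrict I).prod (volume.restrict B)) := by
          rw [← hprod]; exact hvk3.integrable (by norm_num)
        have hw1 : Integrable (uncurry w) ((volume.restrict I).prod (volume.restrict B)) := by
          rw [← hprod]; exact hw.integrable (by norm_num)
        filter_upwards [hvk1.prod_right_ae, hw1.prod_right_ae] with s hvs hws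
        have hI1 : Integrable (fun y => ⟪v k s y, φ y⟫) (volume.restrict B) :=
          (hvs.norm.mul_const Φ₀).mono' (hvs.aestronglyMeasurable.inner
            (hφ.continuous.aestronglyMeasurable)) (Eventually.of_forall fun y =>
              (norm_inner_le_norm _ _).trans (mul_le_mul_of_nonneg_left (hΦ₀ y) (norm_nonneg _)))
        have hI2 : Integrable (fun y => ⟪w s y, φ y⟫) (volume.restrict B) :=
          (hws.norm.mul_const Φ₀).mono' (hws.aestronglyMeasurable.inner
            (hφ.continuous.aestronglyMeasurable)) (Eventually.of_forall fun y =>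
              (norm_inner_le_norm _ _).trans (mul_le_mul_of_nonneg_left (hΦ₀ y) (norm_nonneg _)))
        have e : (g k - G) s = ∫ y in B, ⟪v k s y - w s y, φ y⟫ := by
          show g k s - G s = _
          simp only [hg, hG]
          rw [hpairB, hpairB, ← integral_sub hI1 hI2]
          refine integral_congr_ae (Eventually.of_forall fun y => ?_)
          simp only [inner_sub_left]
        rw [e]
        refine (enorm_integral_le_lintegral_enorm _).trans (lintegral_mono fun y => ?_)
        show ‖⟪v k s y - w s y, φ y⟫‖ₑ ≤ ENNReal.ofReal Φ₀ * ‖(uncurry (v k) - uncurry w) (s, y)‖ₑ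
        rw [← ofReal_norm, ← ofReal_norm, ← ENNReal.ofReal_mul ((norm_nonneg _).trans (hΦ₀ 0))]
        refine ENNReal.ofReal_le_ofReal ?_
        calc ‖⟪v k s y - w s y, φ y⟫‖ ≤ ‖v k s y - w s y‖ * ‖φ y‖ := norm_inner_le_norm _ _
          _ ≤ ‖v k s y - w s y‖ * Φ₀ := by gcongr; exact hΦ₀ y
          _ = Φ₀ * ‖(uncurry (v k) - uncurry w) (s, y)‖ := by rw [mul_comm]; rfl
      refine (lintegral_mono_ae hpt).trans ?_
      have hmeas : AEMeasurable (fun z : ℝ × EuclideanSpace ℝ (Fin 3) =>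
          ENNReal.ofReal Φ₀ * ‖(uncurry (v k) - uncurry w) z‖ₑ)
          ((volume.restrict I).prod (volume.restrict B)) := by
        rw [← hprod]; exact (((hk₀ k hk).1.sub hw.1).enorm.const_mul _)
      rw [lintegral_lintegral hmeas, ← hprod, lintegral_const_mul'' _ ((hk₀ k hk).1.sub hw.1).enorm]
    -- the sliced `L¹` norm tends to zero (Hölder on the finite measure `μ`)
    have hL3to1 : Tendsto (fun k => ENNReal.ofReal Φ₀ * ∫⁻ z, ‖(uncurry (v (k + k₀)) - uncurry w) z‖ₑ ∂μ)
        atTop (𝓝 0) := by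
      have hb : ∀ k, ∫⁻ z, ‖(uncurry (v (k + k₀)) - uncurry w) z‖ₑ ∂μ ≤
          eLpNorm (uncurry (v (k + k₀)) - uncurry w) 3 μ * μ univ ^ (1 / (1 : ℝ≥0∞).toReal - 1 / (3 : ℝ≥0∞).toReal) := by
        intro k
        have h := eLpNorm_le_eLpNorm_mul_rpow_measure_univ (p := 1) (q := 3) (by norm_num)
          (((hk₀ (k + k₀) (Nat.le_add_left _ _)).1.sub hw.1))
        rwa [eLpNorm_one_eq_lintegral_enorm] at h
      have hlim : Tendsto (fun k => eLpNorm (uncurry (v (k + k₀)) - uncurry w) 3 μ *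
          μ univ ^ (1 / (1 : ℝ≥0∞).toReal - 1 / (3 : ℝ≥0∞).toReal)) atTop (𝓝 0) := by
        have h1 : Tendsto (fun k => eLpNorm (uncurry (v (k + k₀)) - uncurry w) 3 μ) atTop (𝓝 0) :=
          (hconv a ha).comp (tendsto_add_atTop_nat k₀)
        have hne : μ univ ^ (1 / (1 : ℝ≥0∞).toReal - 1 / (3 : ℝ≥0∞).toReal) ≠ ⊤ :=
          ENNReal.rpow_ne_top_of_nonneg (by norm_num) (measure_ne_top μ _)
        have h2 := ENNReal.Tendsto.mul_const h1 (Or.inr hne)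
        rwa [zero_mul] at h2
      have h0 : Tendsto (fun k => ∫⁻ z, ‖(uncurry (v (k + k₀)) - uncurry w) z‖ₑ ∂μ) atTop (𝓝 0) :=
        tendsto_of_tendsto_of_tendsto_of_le_of_le tendsto_const_nhds hlim (fun _ => bot_le) hb
      have h3 := ENNReal.Tendsto.const_mul h0 (Or.inr (ENNReal.ofReal_ne_top (r := Φ₀)))
      rwa [mul_zero] at h3
    exact tendsto_of_tendsto_of_tendsto_of_le_of_le tendsto_const_nhds hL3to1 (fun _ => bot_le)
      fun k => hbd (k + k₀) (Nat.le_add_left _ _)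
  -- ## a.e. convergence along a subsequence, and the bound
  have hinm := tendstoInMeasure_of_tendsto_eLpNorm (μ := volume.restrict I) one_ne_zero
    (fun k => hgm (k + k₀) (Nat.le_add_left _ _)) hGm hL1
  obtain ⟨ns, hns, hae⟩ := hinm.exists_seq_tendsto_ae
  have hsub : Ioo s₁ 0 ⊆ I := Ioo_subset_Ioo has le_rfl
  have hae' : ∀ᵐ s ∂(volume.restrict (Ioo s₁ 0)), Tendsto (fun i => g (ns i + k₀) s) atTop (𝓝 (G s)) :=
    ae_restrict_of_ae_restrict_of_subset hsub hae
  have hbd : ∀ᵐ s ∂(volume.restrict (Ioo s₁ 0)), ∀ i, |g (ns i + k₀) s| ≤ ε := by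
    rw [ae_all_iff]
    intro i
    exact (hk₀ (ns i + k₀) (Nat.le_add_left _ _)).2.2
  filter_upwards [hae', hbd] with s hs hb
  exact le_of_tendsto hs.abs (Eventually.of_forall hb)

end Seregin2019

end Literature.Analysis.FluidPDE

end
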